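import Summits.CriticalPhenomena.PercolationContinuityZ3.Theorems.Transplant.FKConnectivityAllQPat3SPGoodCDefs
import Summits.CriticalPhenomena.PercolationContinuityZ3.Theorems.Transplant.FKConnectivityAllQPat3EdgeMinor
import Summits.CriticalPhenomena.PercolationContinuityZ3.Theorems.Transplant.FKConnectivityAllQPat3SlotReach
import HarnessLib

/-!
# Connectivity correlation inequalities for `φ_{w,q}`, every `q > 0` — the ONE-SIDED TWO-SUM LAW along a MARK-FREE slot
# (census g26 §4.5 / census g39 §3 «one-sided law», in the `(E, C)`-minor vocabulary of `…Pat3LevelsC` / `…Pat3SPGoodCDefs`)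

Proof file (`--supports stmt-CriticalPhenomena-4575`), census lineage (gen 40) of LANE 2's FK sub-programme; builds on p205010
(kernel theorem, internal audit signed; external expert review pending).  No definitions, no named facts, no sorries; standard axioms.

SETTING.  A host minor `(E₁, C₁)` (free edges `E₁`, contracted edges `C₁`, all on the vertex set `V₁`) carries the three marks
`x, y, s`; a MARK-FREE piece `(E₂, C₂)` on `V₂` is glued to it along the two vertices `u ≠ v` only (`V₁ ∩ V₂ ⊆ {u, v}`; a mark may
sit at `u` or `v` but not inside the piece); `e = uv` is the VIRTUAL EDGE of the 2-sum, `e ∉ E₁`.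
* (sibling `…Pat3SlotReach.lean`: `FK.reachable_union_free`, `FK.pat3_union_free_of_reach/_of_not_reach` — the host pattern only
  sees the BIT `1{u ↔ v in γ₂}`, so the piece may be replaced by the virtual edge `e`, open iff the bit is set.)
* `FK.apExpC_union_free` — levels: `k + k̄ + 2|V| = (k₁ + k̄₁) + (k₂ + k̄₂) + 1{u↔v in γ₁∪C₁ and in γ₂∪C₂} + 1{same for the
  complements}` (fk-2's parallel junction `clusterCount_parallel` twice); and the three host re-readings
  `FK.apExpC_insert_insert` (`e` opened on the configuration side: the host graph `E₁ + e`), `FK.apExpC_insert_host`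
  (`e` on the complement side: again `E₁ + e`), `FK.apExpC_contract` (both: the minor `(E₁, C₁ + e) = host / e`).
* **`FK.lev2C_union_free_nonneg` — THE LAW, levelwise:** if a two-level table `F` is levelwise nonnegative on the three host
  minors `(E₁, C₁)` (piece deleted), `(E₁ + e, C₁)` (piece replaced by the virtual edge) and `(E₁, C₁ + e)` (piece contracted),
  all read at `(x, y, s)`, then `F` is levelwise nonnegative on the 2-sum `(E₁ ∪ E₂, C₁ ∪ C₂)`.  Proof = census g26 §4.5 verbatim:
  split `γ = γ₁ ⊔ γ₂`; by the bits `(c, d) = (1{u↔v in γ₂∪C₂}, 1{u↔v in γ̄₂∪C₂})` the `γ₁`-sum is a level-shifted copy of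
  `lev2C` of `host` (`c = d = 0`), of `host / e` (`c = d = 1`), or ONE HALF (configurations containing / avoiding `e`) of `lev2C` of
  `host + e` (`c ≠ d`); the involution `γ₂ ↦ E₂ \ γ₂` swaps the two halves at the same piece level (`FK.apExpC_compl`), so they
  only ever occur in pairs summing to a full `lev2C (insert e E₁) C₁`.  Corollaries `FK.lev2_union_free_nonneg` (nothing contracted)
  and the `SPGood(C)` forms **`FK.spGoodC_union_free`**, **`FK.spGood_union_free`** — the recursion step «a mark-free slot of
  the skeleton becomes a plain edge» of census g39's THEOREM SP(W₄-free) programme (FROM-census-g39-SP-W4FREE.md §3, §11 (v)).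
[cite: Grimmett2006, §1.4 eq. (1.20) (p. 15); §3.8 (pp. 61–62)] [cite: AyyerLinussonRavichandran2025, §7 (p. 22)]
-/

namespace Summit.CriticalPhenomena.PercolationContinuityZ3.Theorems

namespace FK

open SimpleGraph Literature.Probability.LatticeModels Literature.Probability.Percolation
open scoped Classical

variable {V : Type*}

/-! ### Levels across a mark-free two-point attachment, with contracted sets -/

section Levels

variable [Fintype V] {E₁ E₂ C₁ C₂ : Finset (Sym2 V)} {V₁ V₂ : Set V} {u v : V}

/-- **Antipodal exponent of the 2-sum with contracted sets**: `k(γ ∪ C) + k(γᶜ ∪ C) + 2|V|` of `γ = γ₁ ⊔ γ₂` inside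
`(E₁ ∪ E₂, C₁ ∪ C₂)` is the sum of the two sides' exponents plus `1{u ↔ v in γ₁ ∪ C₁ and in γ₂ ∪ C₂}` plus the same indicator
for the complements (fk-2's `clusterCount_parallel`, twice). [cite: Grimmett2006, §3.8 (pp. 61–62)] -/
theorem apExpC_union_free (hd : Disjoint E₁ E₂) (h₁ : ∀ e ∈ (↑(E₁ ∪ C₁) : Set (Sym2 V)), ∀ z ∈ e, z ∈ V₁)
    (h₂ : ∀ e ∈ (↑(E₂ ∪ C₂) : Set (Sym2 V)), ∀ z ∈ e, z ∈ V₂) (hS : V₁ ∩ V₂ ⊆ {u, v}) (huv : u ≠ v)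
    {γ₁ γ₂ : Finset (Sym2 V)} (g₁ : γ₁ ⊆ E₁) (g₂ : γ₂ ⊆ E₂) :
    apExpC (E₁ ∪ E₂) (C₁ ∪ C₂) (γ₁ ∪ γ₂) + 2 * Fintype.card V =
      apExpC E₁ C₁ γ₁ + apExpC E₂ C₂ γ₂ +
        (if (openGraph (↑(γ₁ ∪ C₁) : BondConfig V)).Reachable u v ∧
            (openGraph (↑(γ₂ ∪ C₂) : BondConfig V)).Reachable u v then 1 else 0) +
        (if (openGraph (↑(E₁ \ γ₁ ∪ C₁) : BondConfig V)).Reachable u v ∧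
            (openGraph (↑(E₂ \ γ₂ ∪ C₂) : BondConfig V)).Reachable u v then 1 else 0) := by
  have s₁ : (↑(γ₁ ∪ C₁) : Set (Sym2 V)) ⊆ ↑(E₁ ∪ C₁) := Finset.coe_subset.2 (Finset.union_subset_union g₁ (subset_refl _))
  have s₂ : (↑(γ₂ ∪ C₂) : Set (Sym2 V)) ⊆ ↑(E₂ ∪ C₂) := Finset.coe_subset.2 (Finset.union_subset_union g₂ (subset_refl _))
  have t₁ : (↑(E₁ \ γ₁ ∪ C₁) : Set (Sym2 V)) ⊆ ↑(E₁ ∪ C₁) :=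
    Finset.coe_subset.2 (Finset.union_subset_union Finset.sdiff_subset (subset_refl _))
  have t₂ : (↑(E₂ \ γ₂ ∪ C₂) : Set (Sym2 V)) ⊆ ↑(E₂ ∪ C₂) :=
    Finset.coe_subset.2 (Finset.union_subset_union Finset.sdiff_subset (subset_refl _))
  have k1 := clusterCount_parallel h₁ h₂ hS s₁ s₂ huv
  have k2 := clusterCount_parallel h₁ h₂ hS t₁ t₂ huv
  unfold apExpC
  rw [union_sdiff_union hd g₁ g₂, Finset.union_union_union_comm γ₁ γ₂ C₁ C₂,
    Finset.union_union_union_comm (E₁ \ γ₁) (E₂ \ γ₂) C₁ C₂, Finset.coe_union, Finset.coe_union (E₁ \ γ₁ ∪ C₁)]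
  omega

/-- Opening one more edge `e` on top of `ω`: `k(ω + e) + 1 = k(ω) + 1{u ↔ v in ω}` (fk-2's `clusterCount_union_pair_add`). [folklore] -/
theorem clusterCount_insert_add_one (ω : Finset (Sym2 V)) (u v : V) :
    clusterCount (↑(insert s(u, v) ω) : BondConfig V) ∅ + 1 =
      clusterCount (↑ω : BondConfig V) ∅ + (if (openGraph (↑ω : BondConfig V)).Reachable u v then 1 else 0) := by
  have k := clusterCount_union_pair_add (↑ω : BondConfig V) u v
  rw [← Finset.coe_singleton, ← Finset.coe_union, Finset.union_comm, ← Finset.insert_eq] at k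
  by_cases h : (openGraph (↑ω : BondConfig V)).Reachable u v
  · rw [if_pos h] at k ⊢; omega
  · rw [if_neg h] at k ⊢; omega

/-- Host re-reading, `e = uv` opened on the CONFIGURATION side: the exponent of `γ₁ + e` inside `(E₁ + e, C₁)`. [folklore] -/
theorem apExpC_insert_insert {γ₁ : Finset (Sym2 V)} (he : s(u, v) ∉ E₁) (g₁ : γ₁ ⊆ E₁) :
    apExpC (insert s(u, v) E₁) C₁ (insert s(u, v) γ₁) + 1 =
      apExpC E₁ C₁ γ₁ + (if (openGraph (↑(γ₁ ∪ C₁) : BondConfig V)).Reachable u v then 1 else 0) := by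
  have k := clusterCount_insert_add_one (γ₁ ∪ C₁) u v
  unfold apExpC
  rw [insert_sdiff_insert_of_not_mem he, Finset.insert_union]
  have g := g₁
  omega

/-- Host re-reading, `e = uv` opened on the COMPLEMENT side: the exponent of `γ₁` inside `(E₁ + e, C₁)`. [folklore] -/
theorem apExpC_insert_host {γ₁ : Finset (Sym2 V)} (he : s(u, v) ∉ E₁) (g₁ : γ₁ ⊆ E₁) :
    apExpC (insert s(u, v) E₁) C₁ γ₁ + 1 =
      apExpC E₁ C₁ γ₁ + (if (openGraph (↑(E₁ \ γ₁ ∪ C₁) : BondConfig V)).Reachable u v then 1 else 0) := by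
  have k := clusterCount_insert_add_one (E₁ \ γ₁ ∪ C₁) u v
  have hγ : s(u, v) ∉ γ₁ := fun h => he (g₁ h)
  unfold apExpC
  rw [insert_sdiff_of_not_mem hγ, Finset.insert_union]
  omega

/-- Host re-reading, `e = uv` CONTRACTED: the exponent of `γ₁` inside the minor `(E₁, C₁ + e)`. [folklore] -/
theorem apExpC_contract (γ₁ : Finset (Sym2 V)) (u v : V) :
    apExpC E₁ (insert s(u, v) C₁) γ₁ + 2 =
      apExpC E₁ C₁ γ₁ + (if (openGraph (↑(γ₁ ∪ C₁) : BondConfig V)).Reachable u v then 1 else 0) +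
        (if (openGraph (↑(E₁ \ γ₁ ∪ C₁) : BondConfig V)).Reachable u v then 1 else 0) := by
  have k := clusterCount_insert_add_one (γ₁ ∪ C₁) u v
  have k' := clusterCount_insert_add_one (E₁ \ γ₁ ∪ C₁) u v
  unfold apExpC
  rw [Finset.union_insert, Finset.union_insert]
  omega

omit [Fintype V] in
/-- A level-shifted copy of `lev2C` is nonnegative when `lev2C` is nonnegative at every level (empty when the shift exceeds
the level). [folklore] -/
theorem lev2C_shift_nonneg (E C : Finset (Sym2 V)) (x y s : V) {F : ℕ → Pat3 → Pat3 → ℤ}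
    (h : ∀ ν : ℕ, 0 ≤ lev2C E C x y s F ν) (ℓ M : ℕ) :
    0 ≤ ∑ γ ∈ E.powerset, ((if apExpC E C γ + ℓ = M then F 0 (pat3 (γ ∪ C) x y s) (pat3 (E \ γ ∪ C) x y s) else 0) +
      (if apExpC E C γ + 1 + ℓ = M then F 1 (pat3 (γ ∪ C) x y s) (pat3 (E \ γ ∪ C) x y s) else 0)) := by
  by_cases hℓ : ℓ ≤ M
  · have key := h (M - ℓ)
    unfold lev2C at key
    refine le_of_le_of_eq key (Finset.sum_congr rfl fun γ _ => ?_)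
    have e1 : (apExpC E C γ = M - ℓ) ↔ (apExpC E C γ + ℓ = M) := by omega
    have e2 : (apExpC E C γ + 1 = M - ℓ) ↔ (apExpC E C γ + 1 + ℓ = M) := by omega
    rw [ite_eq_ite_of_iff e1 rfl, ite_eq_ite_of_iff e2 rfl]
  · refine le_of_eq (Finset.sum_eq_zero fun γ _ => ?_).symm
    rw [if_neg (by omega), if_neg (by omega), add_zero]

set_option linter.unusedSimpArgs false in
/-- **THE ONE-SIDED TWO-SUM LAW (levelwise, with contracted sets).**  Host minor `(E₁, C₁)` on `V₁` carrying the marks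
`x, y, s`; mark-free piece `(E₂, C₂)` on `V₂`; `V₁ ∩ V₂ ⊆ {u, v}`, `u ≠ v`, virtual edge `e = uv ∉ E₁`.  If the two-level table
`F` is levelwise nonnegative on `(E₁, C₁)`, on `(E₁ + e, C₁)` and on `(E₁, C₁ + e)` (all at `(x, y, s)`), then it is levelwise
nonnegative on the 2-sum `(E₁ ∪ E₂, C₁ ∪ C₂)` (census g26 §4.5: `T(G) = M₀₀ ⋆ T(host) + M₀₁ ⋆ T(host + e) + M₁₁ ⋆ T(host / e)`
with the piece's nonnegative two-point level counts `M`). [cite: AyyerLinussonRavichandran2025, §7 (p. 22)] -/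
theorem lev2C_union_free_nonneg (hd : Disjoint E₁ E₂) (h₁ : ∀ e ∈ (↑(E₁ ∪ C₁) : Set (Sym2 V)), ∀ z ∈ e, z ∈ V₁)
    (h₂ : ∀ e ∈ (↑(E₂ ∪ C₂) : Set (Sym2 V)), ∀ z ∈ e, z ∈ V₂) (hS : V₁ ∩ V₂ ⊆ {u, v}) (huv : u ≠ v)
    (he : s(u, v) ∉ E₁) {x y s : V}
    (hx : x ∈ V₂ → x = u ∨ x = v) (hy : y ∈ V₂ → y = u ∨ y = v) (hs : s ∈ V₂ → s = u ∨ s = v)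
    (F : ℕ → Pat3 → Pat3 → ℤ) (h00 : ∀ ν : ℕ, 0 ≤ lev2C E₁ C₁ x y s F ν)
    (h01 : ∀ ν : ℕ, 0 ≤ lev2C (insert s(u, v) E₁) C₁ x y s F ν)
    (h11 : ∀ ν : ℕ, 0 ≤ lev2C E₁ (insert s(u, v) C₁) x y s F ν) (μ : ℕ) :
    0 ≤ lev2C (E₁ ∪ E₂) (C₁ ∪ C₂) x y s F μ := by
  have s₁ : ∀ {γ : Finset (Sym2 V)}, γ ⊆ E₁ → γ ∪ C₁ ⊆ E₁ ∪ C₁ := fun g => Finset.union_subset_union g (subset_refl _)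
  have s₂ : ∀ {γ : Finset (Sym2 V)}, γ ⊆ E₂ → γ ∪ C₂ ⊆ E₂ ∪ C₂ := fun g => Finset.union_subset_union g (subset_refl _)
  -- averaging over the involution `γ₂ ↦ E₂ \ γ₂`: it suffices that the γ₁-sums are nonnegative IN PAIRS
  have two : ∀ f : Finset (Sym2 V) → ℤ, (∀ γ₂ ∈ E₂.powerset, 0 ≤ f γ₂ + f (E₂ \ γ₂)) →
      0 ≤ ∑ γ₂ ∈ E₂.powerset, f γ₂ := by
    intro f hf
    have h2 : 2 * ∑ γ₂ ∈ E₂.powerset, f γ₂ = ∑ γ₂ ∈ E₂.powerset, (f γ₂ + f (E₂ \ γ₂)) := by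
      rw [two_mul, Finset.sum_add_distrib, ← sum_powerset_flip E₂ f]
    have h3 : 0 ≤ ∑ γ₂ ∈ E₂.powerset, (f γ₂ + f (E₂ \ γ₂)) := Finset.sum_nonneg hf
    omega
  -- the composite summand at a piece configuration `δ` with bits `(c, d)` and a host configuration `γ₁`: levels and sets
  have summand : ∀ δ, δ ⊆ E₂ → ∀ γ₁, γ₁ ⊆ E₁ →
      apExpC (E₁ ∪ E₂) (C₁ ∪ C₂) (γ₁ ∪ δ) + 2 * Fintype.card V =
        apExpC E₁ C₁ γ₁ + apExpC E₂ C₂ δ +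
          (if (openGraph (↑(γ₁ ∪ C₁) : BondConfig V)).Reachable u v ∧
              (openGraph (↑(δ ∪ C₂) : BondConfig V)).Reachable u v then 1 else 0) +
          (if (openGraph (↑(E₁ \ γ₁ ∪ C₁) : BondConfig V)).Reachable u v ∧
              (openGraph (↑(E₂ \ δ ∪ C₂) : BondConfig V)).Reachable u v then 1 else 0) ∧
      (γ₁ ∪ δ ∪ (C₁ ∪ C₂) = (γ₁ ∪ C₁) ∪ (δ ∪ C₂)) ∧
      ((E₁ ∪ E₂) \ (γ₁ ∪ δ) ∪ (C₁ ∪ C₂) = (E₁ \ γ₁ ∪ C₁) ∪ (E₂ \ δ ∪ C₂)) := fun δ hδ γ₁ g₁ =>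
    ⟨apExpC_union_free hd h₁ h₂ hS huv g₁ hδ, Finset.union_union_union_comm _ _ _ _,
      by rw [union_sdiff_union hd g₁ hδ, Finset.union_union_union_comm]⟩
  -- (c, d) = (1, 1): a summand of `lev2C` of host / e, shifted by `2 + ℓ`
  have hW11 : ∀ δ, δ ⊆ E₂ → (openGraph (↑(δ ∪ C₂) : BondConfig V)).Reachable u v →
      (openGraph (↑(E₂ \ δ ∪ C₂) : BondConfig V)).Reachable u v → ∀ γ₁ ∈ E₁.powerset,
      ((if apExpC (E₁ ∪ E₂) (C₁ ∪ C₂) (γ₁ ∪ δ) = μ then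
            F 0 (pat3 (γ₁ ∪ δ ∪ (C₁ ∪ C₂)) x y s) (pat3 ((E₁ ∪ E₂) \ (γ₁ ∪ δ) ∪ (C₁ ∪ C₂)) x y s) else 0) +
          (if apExpC (E₁ ∪ E₂) (C₁ ∪ C₂) (γ₁ ∪ δ) + 1 = μ then
            F 1 (pat3 (γ₁ ∪ δ ∪ (C₁ ∪ C₂)) x y s) (pat3 ((E₁ ∪ E₂) \ (γ₁ ∪ δ) ∪ (C₁ ∪ C₂)) x y s) else 0)) =
        ((if apExpC (E₁) (insert s(u, v) C₁) (γ₁) + (2 + apExpC E₂ C₂ δ) = μ + 2 * Fintype.card V then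
            F 0 (pat3 (γ₁ ∪ insert s(u, v) C₁) x y s) (pat3 (E₁ \ γ₁ ∪ insert s(u, v) C₁) x y s) else 0) +
          (if apExpC (E₁) (insert s(u, v) C₁) (γ₁) + 1 + (2 + apExpC E₂ C₂ δ) = μ + 2 * Fintype.card V then
            F 1 (pat3 (γ₁ ∪ insert s(u, v) C₁) x y s) (pat3 (E₁ \ γ₁ ∪ insert s(u, v) C₁) x y s) else 0)) := by
    intro δ hδ hc hdd γ₁ hγ₁
    have g₁ := Finset.mem_powerset.1 hγ₁
    obtain ⟨hL, hP, hQ⟩ := summand δ hδ γ₁ g₁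
    have hC := apExpC_contract (E₁ := E₁) (C₁ := C₁) γ₁ u v
    rw [hP, hQ, pat3_union_free_of_reach h₁ h₂ hS huv hx hy hs (s₁ g₁) (s₂ hδ) hc,
      pat3_union_free_of_reach h₁ h₂ hS huv hx hy hs (s₁ Finset.sdiff_subset) (s₂ Finset.sdiff_subset) hdd,
      ← Finset.union_insert, ← Finset.union_insert]
    have e1 : apExpC (E₁ ∪ E₂) (C₁ ∪ C₂) (γ₁ ∪ δ) = μ ↔
        apExpC E₁ (insert s(u, v) C₁) γ₁ + (2 + apExpC E₂ C₂ δ) = μ + 2 * Fintype.card V := by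
      by_cases r₁ : (openGraph (↑(γ₁ ∪ C₁) : BondConfig V)).Reachable u v <;>
      by_cases r₂ : (openGraph (↑(E₁ \ γ₁ ∪ C₁) : BondConfig V)).Reachable u v <;>
      simp only [r₁, r₂, hc, hdd, true_and, and_true, false_and, and_false, and_self, if_true, if_false] at hL hC <;> omega
    have e2 : apExpC (E₁ ∪ E₂) (C₁ ∪ C₂) (γ₁ ∪ δ) + 1 = μ ↔
        apExpC E₁ (insert s(u, v) C₁) γ₁ + 1 + (2 + apExpC E₂ C₂ δ) = μ + 2 * Fintype.card V := by
      by_cases r₁ : (openGraph (↑(γ₁ ∪ C₁) : BondConfig V)).Reachable u v <;>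
      by_cases r₂ : (openGraph (↑(E₁ \ γ₁ ∪ C₁) : BondConfig V)).Reachable u v <;>
      simp only [r₁, r₂, hc, hdd, true_and, and_true, false_and, and_false, and_self, if_true, if_false] at hL hC <;> omega
    rw [ite_eq_ite_of_iff e1 rfl, ite_eq_ite_of_iff e2 rfl]
  -- (c, d) = (0, 0): a summand of `lev2C` of the host, shifted by `ℓ`
  have hW00 : ∀ δ, δ ⊆ E₂ → ¬ (openGraph (↑(δ ∪ C₂) : BondConfig V)).Reachable u v →
      ¬ (openGraph (↑(E₂ \ δ ∪ C₂) : BondConfig V)).Reachable u v → ∀ γ₁ ∈ E₁.powerset,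
      ((if apExpC (E₁ ∪ E₂) (C₁ ∪ C₂) (γ₁ ∪ δ) = μ then
            F 0 (pat3 (γ₁ ∪ δ ∪ (C₁ ∪ C₂)) x y s) (pat3 ((E₁ ∪ E₂) \ (γ₁ ∪ δ) ∪ (C₁ ∪ C₂)) x y s) else 0) +
          (if apExpC (E₁ ∪ E₂) (C₁ ∪ C₂) (γ₁ ∪ δ) + 1 = μ then
            F 1 (pat3 (γ₁ ∪ δ ∪ (C₁ ∪ C₂)) x y s) (pat3 ((E₁ ∪ E₂) \ (γ₁ ∪ δ) ∪ (C₁ ∪ C₂)) x y s) else 0)) =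
        ((if apExpC (E₁) (C₁) (γ₁) + (apExpC E₂ C₂ δ) = μ + 2 * Fintype.card V then
            F 0 (pat3 (γ₁ ∪ C₁) x y s) (pat3 (E₁ \ γ₁ ∪ C₁) x y s) else 0) +
          (if apExpC (E₁) (C₁) (γ₁) + 1 + (apExpC E₂ C₂ δ) = μ + 2 * Fintype.card V then
            F 1 (pat3 (γ₁ ∪ C₁) x y s) (pat3 (E₁ \ γ₁ ∪ C₁) x y s) else 0)) := by
    intro δ hδ hc hdd γ₁ hγ₁
    have g₁ := Finset.mem_powerset.1 hγ₁
    obtain ⟨hL, hP, hQ⟩ := summand δ hδ γ₁ g₁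
    rw [hP, hQ, pat3_union_free_of_not_reach h₁ h₂ hS huv hx hy hs (s₁ g₁) (s₂ hδ) hc,
      pat3_union_free_of_not_reach h₁ h₂ hS huv hx hy hs (s₁ Finset.sdiff_subset) (s₂ Finset.sdiff_subset) hdd]
    simp only [hc, hdd, and_false, false_and, if_false, add_zero] at hL
    have e1 : apExpC (E₁ ∪ E₂) (C₁ ∪ C₂) (γ₁ ∪ δ) = μ ↔
        apExpC E₁ C₁ γ₁ + apExpC E₂ C₂ δ = μ + 2 * Fintype.card V := by omega
    have e2 : apExpC (E₁ ∪ E₂) (C₁ ∪ C₂) (γ₁ ∪ δ) + 1 = μ ↔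
        apExpC E₁ C₁ γ₁ + 1 + apExpC E₂ C₂ δ = μ + 2 * Fintype.card V := by omega
    rw [ite_eq_ite_of_iff e1 rfl, ite_eq_ite_of_iff e2 rfl]
  -- (c, d) = (1, 0): the summand of `lev2C` of host + e at the configuration `γ₁ + e`, shifted by `1 + ℓ`
  have hW10 : ∀ δ, δ ⊆ E₂ → (openGraph (↑(δ ∪ C₂) : BondConfig V)).Reachable u v →
      ¬ (openGraph (↑(E₂ \ δ ∪ C₂) : BondConfig V)).Reachable u v → ∀ γ₁ ∈ E₁.powerset,
      ((if apExpC (E₁ ∪ E₂) (C₁ ∪ C₂) (γ₁ ∪ δ) = μ then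
            F 0 (pat3 (γ₁ ∪ δ ∪ (C₁ ∪ C₂)) x y s) (pat3 ((E₁ ∪ E₂) \ (γ₁ ∪ δ) ∪ (C₁ ∪ C₂)) x y s) else 0) +
          (if apExpC (E₁ ∪ E₂) (C₁ ∪ C₂) (γ₁ ∪ δ) + 1 = μ then
            F 1 (pat3 (γ₁ ∪ δ ∪ (C₁ ∪ C₂)) x y s) (pat3 ((E₁ ∪ E₂) \ (γ₁ ∪ δ) ∪ (C₁ ∪ C₂)) x y s) else 0)) =
        ((if apExpC (insert s(u, v) E₁) (C₁) (insert s(u, v) γ₁) + (1 + apExpC E₂ C₂ δ) = μ + 2 * Fintype.card V then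
            F 0 (pat3 (insert s(u, v) γ₁ ∪ C₁) x y s) (pat3 (insert s(u, v) E₁ \ insert s(u, v) γ₁ ∪ C₁) x y s) else 0) +
          (if apExpC (insert s(u, v) E₁) (C₁) (insert s(u, v) γ₁) + 1 + (1 + apExpC E₂ C₂ δ) = μ + 2 * Fintype.card V then
            F 1 (pat3 (insert s(u, v) γ₁ ∪ C₁) x y s) (pat3 (insert s(u, v) E₁ \ insert s(u, v) γ₁ ∪ C₁) x y s) else 0)) := by
    intro δ hδ hc hdd γ₁ hγ₁
    have g₁ := Finset.mem_powerset.1 hγ₁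
    obtain ⟨hL, hP, hQ⟩ := summand δ hδ γ₁ g₁
    have hA := apExpC_insert_insert (C₁ := C₁) he g₁
    rw [hP, hQ, pat3_union_free_of_reach h₁ h₂ hS huv hx hy hs (s₁ g₁) (s₂ hδ) hc,
      pat3_union_free_of_not_reach h₁ h₂ hS huv hx hy hs (s₁ Finset.sdiff_subset) (s₂ Finset.sdiff_subset) hdd,
      ← Finset.insert_union, insert_sdiff_insert_of_not_mem he]
    have e1 : apExpC (E₁ ∪ E₂) (C₁ ∪ C₂) (γ₁ ∪ δ) = μ ↔
        apExpC (insert s(u, v) E₁) C₁ (insert s(u, v) γ₁) + (1 + apExpC E₂ C₂ δ) = μ + 2 * Fintype.card V := by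
      by_cases r₁ : (openGraph (↑(γ₁ ∪ C₁) : BondConfig V)).Reachable u v <;>
      simp only [r₁, hc, hdd, true_and, and_true, false_and, and_false, and_self, if_true, if_false, add_zero] at hL hA <;> omega
    have e2 : apExpC (E₁ ∪ E₂) (C₁ ∪ C₂) (γ₁ ∪ δ) + 1 = μ ↔
        apExpC (insert s(u, v) E₁) C₁ (insert s(u, v) γ₁) + 1 + (1 + apExpC E₂ C₂ δ) = μ + 2 * Fintype.card V := by
      by_cases r₁ : (openGraph (↑(γ₁ ∪ C₁) : BondConfig V)).Reachable u v <;>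
      simp only [r₁, hc, hdd, true_and, and_true, false_and, and_false, and_self, if_true, if_false, add_zero] at hL hA <;> omega
    rw [ite_eq_ite_of_iff e1 rfl, ite_eq_ite_of_iff e2 rfl]
  -- (c, d) = (0, 1): the summand of `lev2C` of host + e at the configuration `γ₁`, shifted by `1 + ℓ`
  have hW01 : ∀ δ, δ ⊆ E₂ → ¬ (openGraph (↑(δ ∪ C₂) : BondConfig V)).Reachable u v →
      (openGraph (↑(E₂ \ δ ∪ C₂) : BondConfig V)).Reachable u v → ∀ γ₁ ∈ E₁.powerset,
      ((if apExpC (E₁ ∪ E₂) (C₁ ∪ C₂) (γ₁ ∪ δ) = μ then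
            F 0 (pat3 (γ₁ ∪ δ ∪ (C₁ ∪ C₂)) x y s) (pat3 ((E₁ ∪ E₂) \ (γ₁ ∪ δ) ∪ (C₁ ∪ C₂)) x y s) else 0) +
          (if apExpC (E₁ ∪ E₂) (C₁ ∪ C₂) (γ₁ ∪ δ) + 1 = μ then
            F 1 (pat3 (γ₁ ∪ δ ∪ (C₁ ∪ C₂)) x y s) (pat3 ((E₁ ∪ E₂) \ (γ₁ ∪ δ) ∪ (C₁ ∪ C₂)) x y s) else 0)) =
        ((if apExpC (insert s(u, v) E₁) (C₁) (γ₁) + (1 + apExpC E₂ C₂ δ) = μ + 2 * Fintype.card V then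
            F 0 (pat3 (γ₁ ∪ C₁) x y s) (pat3 (insert s(u, v) E₁ \ γ₁ ∪ C₁) x y s) else 0) +
          (if apExpC (insert s(u, v) E₁) (C₁) (γ₁) + 1 + (1 + apExpC E₂ C₂ δ) = μ + 2 * Fintype.card V then
            F 1 (pat3 (γ₁ ∪ C₁) x y s) (pat3 (insert s(u, v) E₁ \ γ₁ ∪ C₁) x y s) else 0)) := by
    intro δ hδ hc hdd γ₁ hγ₁
    have g₁ := Finset.mem_powerset.1 hγ₁
    have hγe : s(u, v) ∉ γ₁ := fun h => he (g₁ h)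
    obtain ⟨hL, hP, hQ⟩ := summand δ hδ γ₁ g₁
    have hB := apExpC_insert_host (C₁ := C₁) he g₁
    rw [hP, hQ, pat3_union_free_of_not_reach h₁ h₂ hS huv hx hy hs (s₁ g₁) (s₂ hδ) hc,
      pat3_union_free_of_reach h₁ h₂ hS huv hx hy hs (s₁ Finset.sdiff_subset) (s₂ Finset.sdiff_subset) hdd,
      ← Finset.insert_union, ← insert_sdiff_of_not_mem hγe]
    have e1 : apExpC (E₁ ∪ E₂) (C₁ ∪ C₂) (γ₁ ∪ δ) = μ ↔
        apExpC (insert s(u, v) E₁) C₁ γ₁ + (1 + apExpC E₂ C₂ δ) = μ + 2 * Fintype.card V := by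
      by_cases r₂ : (openGraph (↑(E₁ \ γ₁ ∪ C₁) : BondConfig V)).Reachable u v <;>
      simp only [r₂, hc, hdd, true_and, and_true, false_and, and_false, and_self, if_true, if_false, add_zero] at hL hB <;> omega
    have e2 : apExpC (E₁ ∪ E₂) (C₁ ∪ C₂) (γ₁ ∪ δ) + 1 = μ ↔
        apExpC (insert s(u, v) E₁) C₁ γ₁ + 1 + (1 + apExpC E₂ C₂ δ) = μ + 2 * Fintype.card V := by
      by_cases r₂ : (openGraph (↑(E₁ \ γ₁ ∪ C₁) : BondConfig V)).Reachable u v <;>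
      simp only [r₂, hc, hdd, true_and, and_true, false_and, and_false, and_self, if_true, if_false, add_zero] at hL hB <;> omega
    rw [ite_eq_ite_of_iff e1 rfl, ite_eq_ite_of_iff e2 rfl]
  -- split the composite sum along `γ = γ₁ ⊔ γ₂`, sum over `γ₁` first, and pair `γ₂` with `E₂ \ γ₂`
  unfold lev2C
  rw [sum_powerset_union_disj hd, Finset.sum_comm]
  refine two _ fun γ₂ hγ₂ => ?_
  have g₂ := Finset.mem_powerset.1 hγ₂
  have g₂' : E₂ \ γ₂ ∈ E₂.powerset := Finset.mem_powerset.2 Finset.sdiff_subset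
  have hcc : E₂ \ (E₂ \ γ₂) = γ₂ := Finset.sdiff_sdiff_eq_self g₂
  have hℓ : apExpC E₂ C₂ (E₂ \ γ₂) = apExpC E₂ C₂ γ₂ := apExpC_compl g₂
  by_cases hc : (openGraph (↑(γ₂ ∪ C₂) : BondConfig V)).Reachable u v <;>
  by_cases hdd : (openGraph (↑(E₂ \ γ₂ ∪ C₂) : BondConfig V)).Reachable u v
  · -- (1, 1) and (1, 1)
    rw [Finset.sum_congr rfl (hW11 γ₂ g₂ hc hdd),
      Finset.sum_congr rfl (hW11 (E₂ \ γ₂) Finset.sdiff_subset hdd (by rw [hcc]; exact hc)), hℓ]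
    exact add_nonneg (lev2C_shift_nonneg E₁ _ x y s h11 _ _) (lev2C_shift_nonneg E₁ _ x y s h11 _ _)
  · -- (1, 0) and (0, 1): the two halves of `lev2C` of host + e
    rw [Finset.sum_congr rfl (hW10 γ₂ g₂ hc hdd),
      Finset.sum_congr rfl (hW01 (E₂ \ γ₂) Finset.sdiff_subset hdd (by rw [hcc]; exact hc)), hℓ]
    have key := lev2C_shift_nonneg (insert s(u, v) E₁) C₁ x y s h01 (1 + apExpC E₂ C₂ γ₂) (μ + 2 * Fintype.card V)
    rw [Finset.sum_powerset_insert he] at key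
    exact le_of_le_of_eq key (add_comm _ _)
  · -- (0, 1) and (1, 0)
    rw [Finset.sum_congr rfl (hW01 γ₂ g₂ hc hdd),
      Finset.sum_congr rfl (hW10 (E₂ \ γ₂) Finset.sdiff_subset hdd (by rw [hcc]; exact hc)), hℓ]
    have key := lev2C_shift_nonneg (insert s(u, v) E₁) C₁ x y s h01 (1 + apExpC E₂ C₂ γ₂) (μ + 2 * Fintype.card V)
    rw [Finset.sum_powerset_insert he] at key
    exact key
  · -- (0, 0) and (0, 0)
    rw [Finset.sum_congr rfl (hW00 γ₂ g₂ hc hdd),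
      Finset.sum_congr rfl (hW00 (E₂ \ γ₂) Finset.sdiff_subset hdd (by rw [hcc]; exact hc)), hℓ]
    exact add_nonneg (lev2C_shift_nonneg E₁ C₁ x y s h00 _ _) (lev2C_shift_nonneg E₁ C₁ x y s h00 _ _)

/-- **The one-sided two-sum law with nothing contracted**: `F` levelwise nonnegative on the host `E₁`, on `E₁ + e` and on the
minor `E₁ / e` (contracted set `{e}`) gives `F` levelwise nonnegative on `E₁ ∪ E₂`, for every mark-free piece `E₂` glued along
`{u, v}`, `e = uv ∉ E₁`. [cite: AyyerLinussonRavichandran2025, §7 (p. 22)] -/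
theorem lev2_union_free_nonneg (hd : Disjoint E₁ E₂) (h₁ : ∀ e ∈ (↑E₁ : Set (Sym2 V)), ∀ z ∈ e, z ∈ V₁)
    (h₂ : ∀ e ∈ (↑E₂ : Set (Sym2 V)), ∀ z ∈ e, z ∈ V₂) (hS : V₁ ∩ V₂ ⊆ {u, v}) (huv : u ≠ v)
    (he : s(u, v) ∉ E₁) {x y s : V}
    (hx : x ∈ V₂ → x = u ∨ x = v) (hy : y ∈ V₂ → y = u ∨ y = v) (hs : s ∈ V₂ → s = u ∨ s = v)
    (F : ℕ → Pat3 → Pat3 → ℤ) (h00 : ∀ ν : ℕ, 0 ≤ lev2 E₁ x y s F ν)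
    (h01 : ∀ ν : ℕ, 0 ≤ lev2 (insert s(u, v) E₁) x y s F ν)
    (h11 : ∀ ν : ℕ, 0 ≤ lev2C E₁ {s(u, v)} x y s F ν) (μ : ℕ) :
    0 ≤ lev2 (E₁ ∪ E₂) x y s F μ := by
  rw [← lev2C_empty, ← Finset.union_empty (∅ : Finset (Sym2 V))]
  refine lev2C_union_free_nonneg hd (by rwa [Finset.union_empty]) (by rwa [Finset.union_empty]) hS huv he hx hy hs F
    (fun ν => by rw [lev2C_empty]; exact h00 ν) (fun ν => by rw [lev2C_empty]; exact h01 ν) ?_ μ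
  intro ν
  rw [Finset.insert_empty]
  exact h11 ν

/-- **`SPGoodC` across a mark-free slot** (census g39 §3 «one-sided law; after which the slot is a plain edge»): `SPGoodC` of
the three host minors (piece deleted / replaced by the virtual edge / contracted) gives `SPGoodC` of the 2-sum.
[cite: AyyerLinussonRavichandran2025, §7 (p. 22)] -/
theorem spGoodC_union_free (hd : Disjoint E₁ E₂) (h₁ : ∀ e ∈ (↑(E₁ ∪ C₁) : Set (Sym2 V)), ∀ z ∈ e, z ∈ V₁)
    (h₂ : ∀ e ∈ (↑(E₂ ∪ C₂) : Set (Sym2 V)), ∀ z ∈ e, z ∈ V₂) (hS : V₁ ∩ V₂ ⊆ {u, v}) (huv : u ≠ v)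
    (he : s(u, v) ∉ E₁) {b s t : V}
    (hb : b ∈ V₂ → b = u ∨ b = v) (hs : s ∈ V₂ → s = u ∨ s = v) (ht : t ∈ V₂ → t = u ∨ t = v)
    (g00 : SPGoodC E₁ C₁ b s t) (g01 : SPGoodC (insert s(u, v) E₁) C₁ b s t) (g11 : SPGoodC E₁ (insert s(u, v) C₁) b s t) :
    SPGoodC (E₁ ∪ E₂) (C₁ ∪ C₂) b s t := by
  intro μ
  refine ⟨?_, ?_, ?_, ?_⟩
  · exact lev2C_union_free_nonneg hd h₁ h₂ hS huv he hb hs ht _ (fun ν => (g00 ν).1) (fun ν => (g01 ν).1)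
      (fun ν => (g11 ν).1) μ
  · exact lev2C_union_free_nonneg hd h₁ h₂ hS huv he hb hs ht _ (fun ν => (g00 ν).2.1) (fun ν => (g01 ν).2.1)
      (fun ν => (g11 ν).2.1) μ
  · exact lev2C_union_free_nonneg hd h₁ h₂ hS huv he hb hs ht _ (fun ν => (g00 ν).2.2.1) (fun ν => (g01 ν).2.2.1)
      (fun ν => (g11 ν).2.2.1) μ
  · exact lev2C_union_free_nonneg hd h₁ h₂ hS huv he hb hs ht _ (fun ν => (g00 ν).2.2.2) (fun ν => (g01 ν).2.2.2)
      (fun ν => (g11 ν).2.2.2) μ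

/-- **`SPGood` across a mark-free slot** (nothing contracted on either side): `SPGood E₁`, `SPGood (E₁ + e)` and
`SPGoodC E₁ {e}` give `SPGood (E₁ ∪ E₂)`. [cite: AyyerLinussonRavichandran2025, §7 (p. 22)] -/
theorem spGood_union_free (hd : Disjoint E₁ E₂) (h₁ : ∀ e ∈ (↑E₁ : Set (Sym2 V)), ∀ z ∈ e, z ∈ V₁)
    (h₂ : ∀ e ∈ (↑E₂ : Set (Sym2 V)), ∀ z ∈ e, z ∈ V₂) (hS : V₁ ∩ V₂ ⊆ {u, v}) (huv : u ≠ v)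
    (he : s(u, v) ∉ E₁) {b s t : V}
    (hb : b ∈ V₂ → b = u ∨ b = v) (hs : s ∈ V₂ → s = u ∨ s = v) (ht : t ∈ V₂ → t = u ∨ t = v)
    (g00 : SPGood E₁ b s t) (g01 : SPGood (insert s(u, v) E₁) b s t) (g11 : SPGoodC E₁ {s(u, v)} b s t) :
    SPGood (E₁ ∪ E₂) b s t := by
  intro μ
  refine ⟨?_, ?_, ?_, ?_⟩
  · exact lev2_union_free_nonneg hd h₁ h₂ hS huv he hb hs ht _ (fun ν => (g00 ν).1) (fun ν => (g01 ν).1)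
      (fun ν => (g11 ν).1) μ
  · exact lev2_union_free_nonneg hd h₁ h₂ hS huv he hb hs ht _ (fun ν => (g00 ν).2.1) (fun ν => (g01 ν).2.1)
      (fun ν => (g11 ν).2.1) μ
  · exact lev2_union_free_nonneg hd h₁ h₂ hS huv he hb hs ht _ (fun ν => (g00 ν).2.2.1) (fun ν => (g01 ν).2.2.1)
      (fun ν => (g11 ν).2.2.1) μ
  · exact lev2_union_free_nonneg hd h₁ h₂ hS huv he hb hs ht _ (fun ν => (g00 ν).2.2.2) (fun ν => (g01 ν).2.2.2)
      (fun ν => (g11 ν).2.2.2) μ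

end Levels

end FK

end Summit.CriticalPhenomena.PercolationContinuityZ3.Theorems
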